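import Literature.NumberTheory.LFunctions.DobnerSelbergClassProofs
import Literature.NumberTheory.LFunctions.DobnerLemma4Tools
import Literature.NumberTheory.LFunctions.EquivalentsProofs
import HarnessLib

/-!
# Dobner's Theorem 1 for `F ∈ 𝒮♯` — the reduction to admissibility of `Φ_F`, a strip for `H_0`, and Theorem 2

RH-FREE CONTENT (proof-internal steps of a published RH-free theorem, in the generality of the
extended Selberg class `𝒮♯`; no named facts, no definitions). Trunk T-ANT
(`Literature/NumberTheory/LFunctions`). Node **T1-RED** of the Dobner programme of cell rh-crit/rt
(plan of record HOME/drafts/rt/t7-N1-PLAN.md §6; rt/STATUS 2026-08-26): the set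
`𝒵 = {t : all roots of H_t are real}` (`Literature.NumberTheory.LFunctions.ExtendedSelbergDatum.realZeroTimes`)
of a datum `D` is a closed ray `[Λ_F, ∞)`, GIVEN (i) de Bruijn admissibility of the kernel `Φ_F`
(`Literature.Analysis.Complex.DeBruijn1950.IsAdmissible D.Phi` — node T1-ADM), (ii) a horizontal
strip containing the roots of `H_0` (`Literature.Analysis.Complex.RootsInStrip (D.Ht 0) Δ` — node
T1-STRIP) and (iii) the conclusion of Thm. 2 for `D` (`t < 0 ⇒ H_t` has a non-real root — node N5,
`Literature.NumberTheory.LFunctions.dobner_theorem2`).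

> A. Dobner, *A proof of Newman's conjecture for the extended Selberg class*, Acta Arith. 201
> (2021) = arXiv:2005.05142, proof of Thm. 1, pp. 6–7: "`Φ_F` … satisfies the conditions of
> Theorem 3 … Let `𝒵` denote the set of real `t` such that all roots of `H_t` are real. By
> Theorem 3 [de Bruijn 1950, Thm. 13], if `t ∈ 𝒵` then `t' ∈ 𝒵` for all `t' > t` … since the
> zeros of `ξ^F` lie in a vertical strip, those of `H_0` lie in a horizontal strip `|Im z| ≤ Δ`,
> so `t ∈ 𝒵` for `t > Δ²/2` … `𝒵` is closed by Hurwitz's theorem … by Theorem 2, `𝒵 ≠ ℝ`; hence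
> `𝒵 = [Λ_F, ∞)` for a real number `Λ_F`."

## Contents (all theorems; `D : ExtendedSelbergDatum`)

* the tilted kernels `K_t(u) = e^{tu²} Φ_F(u)`: `ExtendedSelbergDatum.Ht_eq_trigIntegral`
  (`H_t = ∫ K_t(u) e^{izu} du`, by definition), `ExtendedSelbergDatum.isAdmissible_kernel_of_isAdmissible`
  (admissible `Φ_F` ⇒ every `K_t` admissible: the super-Gaussian decay `e^{−|u|^b}`, `b > 2`,
  absorbs `e^{tu²}`);
* analytic consequences: `ExtendedSelbergDatum.differentiable_Ht_of_isAdmissible` (each `H_t`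
  entire, every real `t`; the `t < 0` case from `Φ_F` bounded is t4's
  `ExtendedSelbergDatum.differentiable_Ht`, `DobnerSelbergClassNewmanProofs.lean` —
  `Literature.Analysis.Complex.differentiable_trigIntegral` + exponential moments),
  `ExtendedSelbergDatum.continuous_Ht_uncurry` (`(t, z) ↦ H_t(z)` jointly continuous, dominated
  convergence), `ExtendedSelbergDatum.exists_Ht_ne_zero` (no `H_t` vanishes identically — Fourier
  uniqueness `Literature.Analysis.Complex.exists_trigIntegral_ne_zero`, from `H_0 ≢ 0`);
* the four properties of `𝒵`: `ExtendedSelbergDatum.isClosed_realZeroTimes` (Hurwitz, via the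
  tree's generic `Literature.NumberTheory.LFunctions.HasOnlyRealZeros.isClosed_setOf`),
  `ExtendedSelbergDatum.hasOnlyRealZeros_Ht_mono` (upward closed: Thm. 3 with `Δ = 0`),
  `ExtendedSelbergDatum.hasOnlyRealZeros_Ht_of_strip` (`t > Δ²/2 ⇒ t ∈ 𝒵`: Thm. 3), bounded below
  by `0` (Thm. 2);
* the characterisation `ExtendedSelbergDatum.hasOnlyRealZeros_Ht_iff_of`
  (`H_t` has only real zeros `↔ Λ_F ≤ t`, `Λ_F = D.dbnConst = inf 𝒵`), `dbnConst_nonneg_of`, and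
  the assembly one-liner shape `Literature.NumberTheory.LFunctions.dobner_theorem1_of :
  (∀ D, 0 < k → IsAdmissible D.Phi) → (∀ D, 0 < k → ∃ Δ ≥ 0, RootsInStrip (D.Ht 0) Δ) →
  dobner_theorem2 → dobner_theorem1` (rt-lead ruling (32): `dobner_theorem1_holds :=
  dobner_theorem1_of (fun D hk ↦ D.isAdmissible_Phi hk) (fun D hk ↦ D.exists_rootsInStrip_Ht_zero hk)
  dobner_theorem2_holds` once nodes T1-ADM / T1-STRIP / N5 land), and
  `ExtendedSelbergDatum.dbnConst_spec_of`.

Names: t4's node T1-ADM (`DobnerSelbergClassKernelProofs.lean`) owns `isAdmissible_Phi`,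
`isAdmissible_kernel (hk)`, `differentiable_Ht_all (hk)`, `integrable_kernel_exp_moment_all`, `Ht_add`
(frozen exports, rt/STATUS 2026-08-26T09:12:59Z); the lemmas here take the admissibility of `Φ_F`
as a HYPOTHESIS instead (`…_of_isAdmissible`), so the two files never declare one name twice.

Thm. 3 enters through the tree's `Literature.NumberTheory.LFunctions.rootsInStrip_trigIntegral_gaussian_of_pos`
(= de Bruijn 1950 Thm. 13, `Literature.Analysis.Complex.DeBruijn1950.thm13_holds`).

bears_on: N-C/N-P (COLUMN 3 DBN). WHAT THIS IS NOT: the existence of `Λ_F` for `F ∈ 𝒮♯` is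
RH-free literature (its `ζ`-case is Newman 1976 + de Bruijn 1950, both theorems of this library);
nothing here bears on the truth of RH.
-/

noncomputable section

open Complex Filter Topology Set MeasureTheory
open scoped ComplexConjugate

namespace Literature.NumberTheory.LFunctions

open Literature.Analysis.Complex Literature.Analysis.Complex.DeBruijn1950

namespace ExtendedSelbergDatum

variable (D : ExtendedSelbergDatum)

/-! ## The tilted kernels `K_t(u) = e^{tu²} Φ_F(u)` -/

/-- `H_t = ∫ K_t(u) e^{izu} du` with `K_t(u) = e^{tu²} Φ_F(u)` (definition of `H_t`, p. 6).
[cite: Dobner2021, §2 p. 6 (H_t)] -/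
theorem Ht_eq_trigIntegral (t : ℝ) :
    D.Ht t = trigIntegral fun u : ℝ ↦ ((Real.exp (t * u ^ 2) : ℝ) : ℂ) * D.Phi u := rfl

/-- **Every tilted kernel `K_t = e^{tu²} Φ_F` is de Bruijn-admissible when `Φ_F` is** ("`Φ_F`
satisfies the conditions of Theorem 3", p. 6; the decay `O(e^{−|u|^b})`, `b > 2`, absorbs the
Gaussian `e^{tu²}` at the price of any smaller exponent `b' ∈ (2, b)`; conjugate symmetry and
integrability are inherited). [cite: Dobner2021, proof of Thm. 1, p. 6] -/
theorem isAdmissible_kernel_of_isAdmissible (hΦ : IsAdmissible D.Phi) (t : ℝ) :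
    IsAdmissible fun u : ℝ ↦ ((Real.exp (t * u ^ 2) : ℝ) : ℂ) * D.Phi u where
  integrable := by
    have h := hΦ.integrable_norm_mul_gaussian t 0
    refine h.mono' ?_ (Eventually.of_forall fun u ↦ ?_)
    · exact (Complex.continuous_ofReal.comp (by fun_prop)).aestronglyMeasurable.mul
        hΦ.integrable.aestronglyMeasurable
    · rw [norm_mul, Complex.norm_real, Real.norm_eq_abs, abs_of_pos (Real.exp_pos _), zero_mul,
        Real.exp_zero, mul_one, mul_comm]
  conj_symm := fun u ↦ by
    rw [map_mul, Complex.conj_ofReal, hΦ.conj_symm u, neg_sq]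
  decay := by
    obtain ⟨b, C, hb, hev⟩ := hΦ.decay
    set b' : ℝ := (b + 2) / 2 with hb'
    have hb'2 : 2 < b' := by rw [hb']; linarith
    have hb'b : b' < b := by rw [hb']; linarith
    have hy : ∀ᶠ y : ℝ in atTop, 2 * (|t| + 1) * y ^ (2 : ℝ) ≤ y ^ b ∧ 2 * y ^ b' ≤ y ^ b :=
      (eventually_const_mul_rpow_le_rpow (2 * (|t| + 1)) (show (2 : ℝ) < b from hb)).and
        (eventually_const_mul_rpow_le_rpow 2 hb'b)
    have hu : ∀ᶠ u : ℝ in cocompact ℝ,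
        2 * (|t| + 1) * |u| ^ (2 : ℝ) ≤ |u| ^ b ∧ 2 * |u| ^ b' ≤ |u| ^ b := by
      have h := tendsto_norm_cocompact_atTop (E := ℝ) |>.eventually hy
      simpa only [Real.norm_eq_abs] using h
    refine ⟨b', max C 0, hb'2, ?_⟩
    filter_upwards [hev, hu] with u hΦu hu'
    obtain ⟨h1, h2⟩ := hu'
    rw [norm_mul, Complex.norm_real, Real.norm_eq_abs, abs_of_pos (Real.exp_pos _)]
    have hΦu' : ‖D.Phi u‖ ≤ max C 0 * Real.exp (-|u| ^ b) :=
      hΦu.trans (mul_le_mul_of_nonneg_right (le_max_left _ _) (Real.exp_pos _).le)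
    have hexp : Real.exp (t * u ^ 2) * Real.exp (-|u| ^ b) ≤ Real.exp (-|u| ^ b') := by
      rw [← Real.exp_add, Real.exp_le_exp]
      have hu2 : |u| ^ (2 : ℝ) = u ^ 2 := by rw [Real.rpow_two, sq_abs]
      rw [hu2] at h1
      have h3 : t * u ^ 2 ≤ (|t| + 1) * u ^ 2 :=
        mul_le_mul_of_nonneg_right (by linarith [le_abs_self t]) (sq_nonneg u)
      have h4 : 0 ≤ |u| ^ b' := Real.rpow_nonneg (abs_nonneg u) _
      linarith
    calc Real.exp (t * u ^ 2) * ‖D.Phi u‖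
        ≤ Real.exp (t * u ^ 2) * (max C 0 * Real.exp (-|u| ^ b)) :=
          mul_le_mul_of_nonneg_left hΦu' (Real.exp_pos _).le
      _ = max C 0 * (Real.exp (t * u ^ 2) * Real.exp (-|u| ^ b)) := by ring
      _ ≤ max C 0 * Real.exp (-|u| ^ b') := mul_le_mul_of_nonneg_left hexp (le_max_right _ _)

/-! ## Analytic consequences: `H_t` entire, jointly continuous, not identically zero -/

/-- **Each `H_t` is entire** (admissible kernels have all exponential moments, and one
differentiates under the integral sign). [cite: Dobner2021, proof of Thm. 1, p. 6] -/
theorem differentiable_Ht_of_isAdmissible (hΦ : IsAdmissible D.Phi) (t : ℝ) :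
    Differentiable ℂ (D.Ht t) := by
  rw [Ht_eq_trigIntegral]
  exact differentiable_trigIntegral (D.isAdmissible_kernel_of_isAdmissible hΦ t).integrable.aestronglyMeasurable
    (D.isAdmissible_kernel_of_isAdmissible hΦ t).integrable_norm_mul_exp

/-- **`(t, z) ↦ H_t(z)` is jointly continuous** on `ℝ × ℂ` (dominated convergence with the bound
`e^{(t₀+1)u²} |Φ_F(u)| e^{(|z₀|+1)|u|}` near `(t₀, z₀)`, integrable by admissibility).
[cite: Dobner2021, proof of Thm. 1, p. 7 (Hurwitz step)] -/
theorem continuous_Ht_uncurry (hΦ : IsAdmissible D.Phi) : Continuous (Function.uncurry D.Ht) := by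
  have e : Function.uncurry D.Ht = fun p : ℝ × ℂ ↦
      ∫ u : ℝ, ((Real.exp (p.1 * u ^ 2) : ℝ) : ℂ) * D.Phi u * Complex.exp (I * p.2 * u) := by
    funext p; rfl
  rw [e]
  refine continuous_iff_continuousAt.2 fun p₀ ↦ ?_
  refine continuousAt_of_dominated
    (bound := fun u ↦ ‖D.Phi u‖ * (Real.exp ((p₀.1 + 1) * u ^ 2) * Real.exp ((‖p₀.2‖ + 1) * |u|)))
    (Eventually.of_forall fun p ↦ ?_) ?_ (hΦ.integrable_norm_mul_gaussian (p₀.1 + 1) (‖p₀.2‖ + 1)) ?_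
  · exact ((Complex.continuous_ofReal.comp (by fun_prop)).aestronglyMeasurable.mul
      hΦ.integrable.aestronglyMeasurable).mul (by fun_prop : Continuous fun u : ℝ ↦
        Complex.exp (I * p.2 * u)).aestronglyMeasurable
  · filter_upwards [Metric.ball_mem_nhds p₀ one_pos] with p hp
    refine Eventually.of_forall fun u ↦ ?_
    rw [← ball_prod_same, Set.mem_prod] at hp
    obtain ⟨hp1, hp2⟩ := hp
    have h1 : p.1 ≤ p₀.1 + 1 := by
      rw [Metric.mem_ball, Real.dist_eq] at hp1
      linarith [le_abs_self (p.1 - p₀.1)]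
    have h2 : ‖p.2‖ ≤ ‖p₀.2‖ + 1 := by
      rw [Metric.mem_ball, dist_eq_norm] at hp2
      calc ‖p.2‖ = ‖p₀.2 + (p.2 - p₀.2)‖ := by ring_nf
        _ ≤ ‖p₀.2‖ + ‖p.2 - p₀.2‖ := norm_add_le _ _
        _ ≤ ‖p₀.2‖ + 1 := by linarith
    have e1 : Real.exp (p.1 * u ^ 2) ≤ Real.exp ((p₀.1 + 1) * u ^ 2) :=
      Real.exp_le_exp.2 (mul_le_mul_of_nonneg_right h1 (sq_nonneg u))
    have e2 : ‖Complex.exp (I * p.2 * u)‖ ≤ Real.exp ((‖p₀.2‖ + 1) * |u|) :=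
      (norm_cexp_I_mul_mul_le p.2 u).trans
        (Real.exp_le_exp.2 (mul_le_mul_of_nonneg_right h2 (abs_nonneg u)))
    rw [norm_mul, norm_mul, Complex.norm_real, Real.norm_eq_abs, abs_of_pos (Real.exp_pos _)]
    calc Real.exp (p.1 * u ^ 2) * ‖D.Phi u‖ * ‖Complex.exp (I * p.2 * u)‖
        = ‖D.Phi u‖ * (Real.exp (p.1 * u ^ 2) * ‖Complex.exp (I * p.2 * u)‖) := by ring
      _ ≤ ‖D.Phi u‖ * (Real.exp ((p₀.1 + 1) * u ^ 2) * Real.exp ((‖p₀.2‖ + 1) * |u|)) :=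
          mul_le_mul_of_nonneg_left (mul_le_mul e1 e2 (norm_nonneg _) (Real.exp_pos _).le)
            (norm_nonneg _)
  · refine Eventually.of_forall fun u ↦ ?_
    have he : Continuous fun p : ℝ × ℂ ↦ ((Real.exp (p.1 * u ^ 2) : ℝ) : ℂ) :=
      Complex.continuous_ofReal.comp (by fun_prop)
    have hc : Continuous fun p : ℝ × ℂ ↦ Complex.exp (I * p.2 * u) := by fun_prop
    exact ((he.mul continuous_const).mul hc).continuousAt

/-- A strip for the roots of `H_0` forces `Φ_F ≠ 0` (not a.e. zero): otherwise `H_0 ≡ 0`, and every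
point would be a root. [cite: Dobner2021, proof of Thm. 1, p. 6] -/
theorem not_Phi_ae_eq_zero {Δ : ℝ} (hstrip : RootsInStrip (D.Ht 0) Δ) : ¬ D.Phi =ᵐ[volume] 0 := by
  intro h
  obtain ⟨z, hz⟩ := hstrip.exists_ne_zero
  refine hz ?_
  rw [Ht_eq_trigIntegral]
  refine trigIntegral_eq_zero_of_ae_eq_zero ?_ z
  filter_upwards [h] with u hu
  simp [hu]

/-- **No `H_t` vanishes identically** (given a strip for `H_0`): the kernel `K_t = e^{tu²} Φ_F` is
integrable and not a.e. zero, so its trigonometric integral is not identically zero (uniqueness of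
the Fourier transform on `L¹`). [cite: Dobner2021, proof of Thm. 1, p. 7 (Hurwitz step)] -/
theorem exists_Ht_ne_zero (hΦ : IsAdmissible D.Phi) {Δ : ℝ} (hstrip : RootsInStrip (D.Ht 0) Δ)
    (t : ℝ) : ∃ z : ℂ, D.Ht t z ≠ 0 := by
  have hK0 : ¬ (fun u : ℝ ↦ ((Real.exp (t * u ^ 2) : ℝ) : ℂ) * D.Phi u) =ᵐ[volume] 0 := by
    intro h
    refine D.not_Phi_ae_eq_zero hstrip ?_
    filter_upwards [h] with u hu
    have hexp : ((Real.exp (t * u ^ 2) : ℝ) : ℂ) ≠ 0 :=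
      Complex.ofReal_ne_zero.2 (Real.exp_pos _).ne'
    simpa [hexp] using hu
  obtain ⟨x, hx⟩ := exists_trigIntegral_ne_zero (D.isAdmissible_kernel_of_isAdmissible hΦ t).integrable hK0
  exact ⟨x, by rw [Ht_eq_trigIntegral]; exact hx⟩

/-! ## The four properties of `𝒵 = {t | H_t has only real zeros}` -/

/-- **`𝒵` is closed** ("by Hurwitz's theorem", p. 7): the tree's generic closedness theorem for a
jointly continuous family of entire functions none of which vanishes identically.
[cite: Dobner2021, proof of Thm. 1, p. 7] -/
theorem isClosed_realZeroTimes (hΦ : IsAdmissible D.Phi) {Δ : ℝ}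
    (hstrip : RootsInStrip (D.Ht 0) Δ) : IsClosed D.realZeroTimes :=
  HasOnlyRealZeros.isClosed_setOf (D.differentiable_Ht_of_isAdmissible hΦ) (D.continuous_Ht_uncurry hΦ)
    (D.exists_Ht_ne_zero hΦ hstrip)

/-- **`𝒵` is upward closed** ("if `t ∈ 𝒵` then `t' ∈ 𝒵` for all `t' > t`", p. 6): Thm. 3 (de
Bruijn's Thm. 13) with `Δ = 0` applied to the admissible kernel `K_{t₀}`, whose Gaussian tilt by
`e^{(t−t₀)u²}` is `K_t`. [cite: Dobner2021, proof of Thm. 1, p. 6] -/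
theorem hasOnlyRealZeros_Ht_mono (hΦ : IsAdmissible D.Phi) {t₀ t : ℝ} (ht : t₀ ≤ t)
    (h : HasOnlyRealZeros (D.Ht t₀)) : HasOnlyRealZeros (D.Ht t) := by
  rcases eq_or_lt_of_le ht with rfl | hlt
  · exact h
  have hroots : RootsInStrip
      (trigIntegral fun u : ℝ ↦ ((Real.exp (t₀ * u ^ 2) : ℝ) : ℂ) * D.Phi u) 0 := by
    intro z hz
    rw [← Ht_eq_trigIntegral] at hz
    rw [h z hz, abs_zero]
  have h3 := rootsInStrip_trigIntegral_gaussian_of_pos (D.isAdmissible_kernel_of_isAdmissible hΦ t₀) le_rfl hroots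
    (t := t - t₀) (by linarith)
  have hker : (fun u : ℝ ↦ ((Real.exp ((t - t₀) * u ^ 2) : ℝ) : ℂ) *
      (((Real.exp (t₀ * u ^ 2) : ℝ) : ℂ) * D.Phi u)) =
      fun u ↦ ((Real.exp (t * u ^ 2) : ℝ) : ℂ) * D.Phi u := by
    funext u
    rw [← mul_assoc, ← Complex.ofReal_mul, ← Real.exp_add]
    congr 3
    ring
  have hmax : Real.sqrt (max ((0 : ℝ) ^ 2 - 2 * (t - t₀)) 0) = 0 := by
    rw [max_eq_right (by linarith)]
    exact Real.sqrt_zero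
  rw [hker, hmax, ← Ht_eq_trigIntegral] at h3
  exact (rootsInStrip_zero_iff _).1 h3

/-- **`t ∈ 𝒵` for `t > Δ²/2`** if the roots of `H_0` lie in `|Im z| ≤ Δ` ("`𝒵` is nonempty", p. 6):
Thm. 3 at `t₀ = 0`, where the strip `√max(Δ² − 2t, 0)` collapses to the real axis.
[cite: Dobner2021, proof of Thm. 1, p. 6] -/
theorem hasOnlyRealZeros_Ht_of_strip (hΦ : IsAdmissible D.Phi) {Δ : ℝ} (hΔ : 0 ≤ Δ)
    (hstrip : RootsInStrip (D.Ht 0) Δ) {t : ℝ} (ht : Δ ^ 2 / 2 < t) :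
    HasOnlyRealZeros (D.Ht t) := by
  have hroots : RootsInStrip
      (trigIntegral fun u : ℝ ↦ ((Real.exp (0 * u ^ 2) : ℝ) : ℂ) * D.Phi u) Δ := by
    rw [← Ht_eq_trigIntegral]; exact hstrip
  have ht0 : 0 < t := lt_of_le_of_lt (by positivity) ht
  have h3 := rootsInStrip_trigIntegral_gaussian_of_pos (D.isAdmissible_kernel_of_isAdmissible hΦ 0) hΔ hroots ht0
  have hker : (fun u : ℝ ↦ ((Real.exp (t * u ^ 2) : ℝ) : ℂ) *
      (((Real.exp (0 * u ^ 2) : ℝ) : ℂ) * D.Phi u)) =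
      fun u ↦ ((Real.exp (t * u ^ 2) : ℝ) : ℂ) * D.Phi u := by
    funext u
    rw [zero_mul, Real.exp_zero, Complex.ofReal_one, one_mul]
  have hmax : Real.sqrt (max (Δ ^ 2 - 2 * t) 0) = 0 := by
    rw [max_eq_right (by linarith)]
    exact Real.sqrt_zero
  rw [hker, hmax, ← Ht_eq_trigIntegral] at h3
  exact (rootsInStrip_zero_iff _).1 h3

/-! ## The characterisation `H_t has only real zeros ↔ Λ_F ≤ t` -/

/-- **Thm. 1 for one datum, modulo its three inputs**: if `Φ_F` is admissible, the roots of `H_0`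
lie in a strip `|Im z| ≤ Δ`, and `H_t` has a non-real root for every `t < 0` (Thm. 2), then for
every real `t`: `H_t` has only real zeros iff `Λ_F ≤ t`, where `Λ_F = inf 𝒵`
(`Literature.NumberTheory.LFunctions.ExtendedSelbergDatum.dbnConst`). Proof: `𝒵` is bounded below
(by `0`), nonempty (`Δ²/2 + 1 ∈ 𝒵`), closed (so `Λ_F ∈ 𝒵`) and upward closed.
[cite: Dobner2021, Thm. 1 (proof, pp. 6–7)] -/
theorem hasOnlyRealZeros_Ht_iff_of (hΦ : IsAdmissible D.Phi) {Δ : ℝ} (hΔ : 0 ≤ Δ)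
    (hstrip : RootsInStrip (D.Ht 0) Δ) (h2 : ∀ t : ℝ, t < 0 → ¬ HasOnlyRealZeros (D.Ht t))
    (t : ℝ) : HasOnlyRealZeros (D.Ht t) ↔ D.dbnConst ≤ t := by
  have hbdd : BddBelow D.realZeroTimes :=
    ⟨0, fun t' ht' ↦ le_of_not_gt fun hlt ↦ h2 t' hlt ht'⟩
  have hne : D.realZeroTimes.Nonempty :=
    ⟨Δ ^ 2 / 2 + 1, D.hasOnlyRealZeros_Ht_of_strip hΦ hΔ hstrip (by linarith)⟩
  have hclosed := D.isClosed_realZeroTimes hΦ hstrip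
  rw [dbnConst]
  constructor
  · exact fun ht ↦ csInf_le hbdd ht
  · intro ht
    exact D.hasOnlyRealZeros_Ht_mono hΦ ht (hclosed.csInf_mem hne hbdd)

/-- Under the same three inputs, `Λ_F ≥ 0` (Thm. 2: no `t < 0` lies in `𝒵`, and `Λ_F ∈ 𝒵`).
[cite: Dobner2021, Thm. 2] -/
theorem dbnConst_nonneg_of (hΦ : IsAdmissible D.Phi) {Δ : ℝ} (hΔ : 0 ≤ Δ)
    (hstrip : RootsInStrip (D.Ht 0) Δ) (h2 : ∀ t : ℝ, t < 0 → ¬ HasOnlyRealZeros (D.Ht t)) :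
    0 ≤ D.dbnConst :=
  le_of_not_gt fun hlt ↦ h2 _ hlt ((D.hasOnlyRealZeros_Ht_iff_of hΦ hΔ hstrip h2 _).2 le_rfl)

end ExtendedSelbergDatum

/-- **Dobner's Thm. 1 from its three inputs** (the assembly one-liner shape for the programme): if for
every datum with `k ≥ 1` the kernel `Φ_F` is de Bruijn-admissible (Lemma 2 route, p. 6) and the
roots of `H_0` lie in a horizontal strip (zero-free half-plane of `F` + functional equation), then
Thm. 2 (`Literature.NumberTheory.LFunctions.dobner_theorem2`) implies Thm. 1
(`Literature.NumberTheory.LFunctions.dobner_theorem1`), with `Λ_F = D.dbnConst`.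
[cite: Dobner2021, Thm. 1 (proof, pp. 6–7)] -/
theorem dobner_theorem1_of
    (hadm : ∀ D : ExtendedSelbergDatum, 0 < D.numGamma →
      Literature.Analysis.Complex.DeBruijn1950.IsAdmissible D.Phi)
    (hstrip : ∀ D : ExtendedSelbergDatum, 0 < D.numGamma →
      ∃ Δ : ℝ, 0 ≤ Δ ∧ Literature.Analysis.Complex.RootsInStrip (D.Ht 0) Δ)
    (h2 : dobner_theorem2) : dobner_theorem1 := by
  intro D hk
  obtain ⟨Δ, hΔ, hs⟩ := hstrip D hk
  exact ⟨D.dbnConst, D.hasOnlyRealZeros_Ht_iff_of (hadm D hk) hΔ hs (h2 D hk)⟩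

/-- The same assembly for ONE datum, with the value `Λ_F = D.dbnConst` and its sign:
`(∀ t, H_t has only real zeros ↔ Λ_F ≤ t) ∧ 0 ≤ Λ_F`. [cite: Dobner2021, Thms. 1–2] -/
theorem ExtendedSelbergDatum.dbnConst_spec_of (D : ExtendedSelbergDatum)
    (hΦ : Literature.Analysis.Complex.DeBruijn1950.IsAdmissible D.Phi) {Δ : ℝ} (hΔ : 0 ≤ Δ)
    (hstrip : Literature.Analysis.Complex.RootsInStrip (D.Ht 0) Δ)
    (h2 : ∀ t : ℝ, t < 0 → ¬ HasOnlyRealZeros (D.Ht t)) :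
    (∀ t : ℝ, HasOnlyRealZeros (D.Ht t) ↔ D.dbnConst ≤ t) ∧ 0 ≤ D.dbnConst :=
  ⟨D.hasOnlyRealZeros_Ht_iff_of hΦ hΔ hstrip h2, D.dbnConst_nonneg_of hΦ hΔ hstrip h2⟩

end Literature.NumberTheory.LFunctions

end
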